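import Summits.AnomalousDissipation.AnomalousDissipation.Theses.TameRoughRigidity
import Summits.AnomalousDissipation.AnomalousDissipation.Theorems.EnsembleRigidityGPStatisticalRigidityPartial
import Summits.AnomalousDissipation.AnomalousDissipation.Theorems.GPStatisticalRigidity.Negative.LoadBearing
import HarnessLib

/-!
# Load-bearing hypotheses of `TameRoughRigidity.TameClosure` (stmt-AnomalousDissipation-18402) — negative side

Crux-attack seat `refuter-rattack-stmt-AnomalousDissipation-18402-0` (2026-08-17). Kernel-checked negative
knowledge about the crux K = TAME CLOSURE ("tame near-statistics of forced Euler with f_GP for every defect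
r > 0 at level (E, G₁) ⇒ an exact FMRT stationary statistical solution at the same level"); nothing here
asserts a Theses statement.

* `tameClosure_conclusion_false_smallEnergy` — the CONCLUSION of K is false at every level `E < 3/(4π)`:
  f_GP carries no stationary statistical solution of forced Euler with integrable energy `≤ E` there
  (landed second-moment test `gpRigid_smallEnergy` at `R = 0`). So below the horizon K holds only through
  the vacuity of its hypothesis, and any witness family for the hypothesis must live at `E ≥ 3/(4π)`.
* `tameClosure_false_without_prob` — with `IsProbabilityMeasure μ` deleted from the near-statistics, the
  ZERO MEASURE meets the hypothesis at `(E, G₁) = (0, 0)` for every `r > 0`; the conclusion is false there.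
  Any proof must use the mass normalisation of the approximants.
* `tameClosure_false_without_defect` — with the cylindrical forced-Euler defect clause deleted, the Dirac
  mass AT REST meets the hypothesis at `(0, 0)`; the conclusion is false there. Any proof must use the
  defect clause.

(The `Integrable ‖v‖²` clauses are, on the contrary, redundant given `ensembleEnstrophy < ⊤`:
`GPStatisticalRigidity.Negative.integrable_norm_sq_of_ensembleEnstrophy_lt_top`.)
-/

noncomputable section

open MeasureTheory UnitAddTorus
open scoped InnerProductSpace ENNReal

-- every `Summit.AnomalousDissipation.AnomalousDissipation.…` name repeats the summit = sub-problem segment (D-0017 layout)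
set_option linter.dupNamespace false

namespace Summit.AnomalousDissipation.AnomalousDissipation.Theorems.TameClosure.Negative

open Literature.Analysis.FunctionSpaces Literature.Analysis.FluidPDE
open Summit.AnomalousDissipation.AnomalousDissipation.Theorems.EnsembleRigidity
open Summit.AnomalousDissipation.AnomalousDissipation.Theorems.EnsembleRigidity.GPStatisticalRigidity

/-- Local notation: the energy space `H`. -/
local notation "H3" => (Torus.energySpace (Fin 3))

/-! ## §1 The conclusion of K is false below the second-moment horizon -/

/-- **No exact tame (indeed no integrable-energy) stationary forced-Euler statistics of `f_GP` below the
horizon**: for `E < 3/(4π)` there is no `μ` with `IsStationaryStatisticalSolution 0 f_GP μ`, integrable energy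
and `ensembleEnergy μ ≤ E` (the landed rigidity block `gpRigid_smallEnergy` at `R = 0`). In particular the
conclusion of `TameClosure` fails at every such level, whatever `G₁`. -/
theorem tameClosure_conclusion_false_smallEnergy (E : ℝ) (hE : E < 3 / (4 * Real.pi)) :
    ¬ ∃ μ : Measure H3, Torus.IsStationaryStatisticalSolution 0 gpForce μ ∧
      Integrable (fun v : H3 => ‖v‖ ^ 2) μ ∧ Torus.ensembleEnergy μ ≤ E := by
  rintro ⟨μ, hμ, hint, hEμ⟩
  obtain ⟨c, δ₀, hc, hδ₀, hrig⟩ := gpRigid_smallEnergy gpForce rfl E hE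
  have hG : Torus.ensembleEnstrophy μ < ⊤ := hμ.enstrophy_finite
  have key := hrig μ hμ.prob hint hEμ hG 0 le_rfl hδ₀.le
    (fun Φ => ⟨(hμ.generator Φ).1, by
      rw [(hμ.generator Φ).2, abs_zero, zero_mul]⟩)
  rw [zero_mul] at key
  exact absurd key (not_le.mpr hc)

/-- The same for the conclusion of K verbatim (with the enstrophy bound), at any `G₁`. -/
theorem tameClosure_conclusion_false_smallEnergy' (E G₁ : ℝ) (hE : E < 3 / (4 * Real.pi)) :
    ¬ ∃ μ : Measure H3, Torus.IsStationaryStatisticalSolution 0 gpForce μ ∧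
      Integrable (fun v : H3 => ‖v‖ ^ 2) μ ∧ Torus.ensembleEnergy μ ≤ E ∧
      Torus.ensembleEnstrophy μ ≤ ENNReal.ofReal G₁ := by
  rintro ⟨μ, hμ, hint, hEμ, -⟩
  exact tameClosure_conclusion_false_smallEnergy E hE ⟨μ, hμ, hint, hEμ⟩

/-! ## §2 Load-bearing: the probability normalisation of the approximants -/

/-- `TameClosure` with `IsProbabilityMeasure μ` DELETED from the hypothesis (the near-statistics), everything
else verbatim (force pinned as `gpForce`, by `rfl` the inline expression of the route declaration). -/
def TameClosureWithoutProb : Prop :=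
  ∀ E G₁ : ℝ, (∀ r : ℝ, 0 < r → ∃ μ : Measure H3,
      Integrable (fun v : H3 => ‖v‖ ^ 2) μ ∧ Torus.ensembleEnergy μ ≤ E ∧
      Torus.ensembleEnstrophy μ ≤ ENNReal.ofReal G₁ ∧
      (∀ Φ : Torus.CylindricalTest (Fin 3),
        Integrable (fun v : H3 => Torus.nsGeneratorPairing 0 gpForce v (Φ.grad v)) μ ∧
          |∫ v, Torus.nsGeneratorPairing 0 gpForce v (Φ.grad v) ∂μ| ≤
            r * Real.sqrt (∫ v, Torus.gradNormSq (Φ.grad v) ∂μ))) →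
    ∃ μ : Measure H3, Torus.IsStationaryStatisticalSolution 0 gpForce μ ∧
      Integrable (fun v : H3 => ‖v‖ ^ 2) μ ∧ Torus.ensembleEnergy μ ≤ E ∧
      Torus.ensembleEnstrophy μ ≤ ENNReal.ofReal G₁

/-- **Any proof of K must use the probability normalisation of the approximants**: the zero measure is an
un-normalised "near-statistics" with defect `0 ≤ r·0` at level `(0, 0)` for every `r > 0`, while no exact
statistics exists at level `0 < 3/(4π)`. -/
theorem tameClosure_false_without_prob : ¬ TameClosureWithoutProb := by
  intro h
  refine tameClosure_conclusion_false_smallEnergy' 0 0 (by positivity) (h 0 0 ?_)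
  intro r _hr
  refine ⟨0, integrable_zero_measure, by simp [Torus.ensembleEnergy], by simp [Torus.ensembleEnstrophy],
    fun Φ => ⟨integrable_zero_measure, ?_⟩⟩
  simp

/-! ## §3 Load-bearing: the defect clause of the approximants -/

/-- `TameClosure` with the cylindrical forced-Euler DEFECT CLAUSE DELETED from the hypothesis, everything else
verbatim. -/
def TameClosureWithoutDefect : Prop :=
  ∀ E G₁ : ℝ, (∀ r : ℝ, 0 < r → ∃ μ : Measure H3, IsProbabilityMeasure μ ∧
      Integrable (fun v : H3 => ‖v‖ ^ 2) μ ∧ Torus.ensembleEnergy μ ≤ E ∧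
      Torus.ensembleEnstrophy μ ≤ ENNReal.ofReal G₁) →
    ∃ μ : Measure H3, Torus.IsStationaryStatisticalSolution 0 gpForce μ ∧
      Integrable (fun v : H3 => ‖v‖ ^ 2) μ ∧ Torus.ensembleEnergy μ ≤ E ∧
      Torus.ensembleEnstrophy μ ≤ ENNReal.ofReal G₁

/-- **Any proof of K must use the defect clause**: the Dirac mass at rest (energy, enstrophy `0`) meets the
defect-free hypothesis at level `(0, 0)` for every `r`, while no exact statistics exists at level `0`. (With
the defect clause the state of rest is excluded for `r < ‖f_GP‖_{Ḣ⁻¹} = √(3/2)/(2π)`.) -/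
theorem tameClosure_false_without_defect : ¬ TameClosureWithoutDefect := by
  intro h
  refine tameClosure_conclusion_false_smallEnergy' 0 0 (by positivity) (h 0 0 ?_)
  intro r _hr
  refine ⟨Measure.dirac 0, inferInstance, ?_, ?_, ?_⟩
  · exact (integrable_const (‖(0 : H3)‖ ^ 2)).congr (ae_eq_dirac (fun v : H3 => ‖v‖ ^ 2)).symm
  · unfold Torus.ensembleEnergy
    rw [integral_dirac]
    simp
  · rw [GPStatisticalRigidity.Negative.ensembleEnstrophy_dirac_zero]
    exact bot_le

end Summit.AnomalousDissipation.AnomalousDissipation.Theorems.TameClosure.Negative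

end
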